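import Literature.MathematicalPhysics.QuantumFieldTheory.Balaban1983to89.Node00.Record12
import Literature.Barriers.QuantumFields.UnitaryHaarSmallBall

/-!
# K0′ ∕ RECORD13 gate ROW P11 — the background proviso `BgProviso` is OVER-RANGED as typed (kernel certificate)

Cell `pub-ymgap`, seat `pub-ymgap-dag-n21-c` (g4; R134 (a) N21 NE7c s1 «name + discharge the first hypothesis with no discharger»),
`--supports stmt-QuantumFields-19902 --as helper` (K0′; dag-lead OPS-NOTE-16 key for ROW P11 work).  COUNT-NEUTRAL.

HONEST FRAMING.  A LOCATED TYPING DEFECT with a kernel certificate — nothing of Bałaban's is contradicted, nothing of Bałaban's is asserted,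
no node is discharged; one finite `T⁴` torus at fixed `ε`; not continuum ∕ OS ∕ mass-gap ∕ Clay.  `N = 2` where a witness is needed (K0′ is keyed
at `N = 2`), general `N` elsewhere.  Theorems only: 0 `def`, 0 `sorry`, no instance ∕ notation; every input consumed BY NAME.

THE ROW.  The RECORD13 closability gate (dag-lead `RECORD13-CLOSABILITY-GATE.md` v0.3) lists ONE pen-less analysis row, P11 = the field
`Stage12Params.Provisos₁₂.bg` (`Node00/Record12.lean` :645), i.e. 11c's `Node00.BgProviso F N K S Rz M n Supp U` (`Node00/Sect2FormOfRecord.lean`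
:289) read at def-R's objects `Supp := regSuppOfRecord … cR`, `U := UbgMSOfRecord …` (n ≥ 1): for EVERY sequence `s`, every retained `𝐖`, every
scale `1 ≤ j ≤ n` and EVERY localization domain `X : (Sect2.domSys (F.P K) M j).Dom`, the background read in `Φ` lies in
`Sect2.spaceI … j (domSites X) (α_{0,j}(g_j)) (α_{1,j}(g_j))` = [I]'s single-scale `U^c_j(X, α_{0,j}, α_{1,j})` AND in the multi-scale `Ũ^c_j`.

THE PRINT ([Balaban1988Convergent] = [III]).  p. 259, (2.26)–(2.27): «𝐄^{(j)}(U_k, z) = Σ_{X ∈ 𝐃_j, z ∈ X ⊂ Λ_j} 𝐄^{(j)}(X, U_k, z), where the last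
sum is over localization domains X ∈ 𝐃_j contained in Λ_j»; the term «(ii) there exists an analytic function 𝐄^{(j)}(X, (𝐔, 𝐉), z) of the variables
(𝐔, 𝐉) ∈ U^c_j(X, α_{0,j}, α_{1,j}), which is an extension of this term»; p. 260, (2.30): «with the summation over localization domains X ∈ 𝐃_j
contained in Λ_j^{∼−1}»; p. 261, (2.41): the boundary terms over «X ∩ Ω_j ≠ ∅, X ∩ Z_j^∼ ≠ ∅» on the MULTI-SCALE space `Ũ^c_j(X, α̃₀, α̃₁)` whose
radii (2.34) are LAYERED, `(1 − β(1 − 2^{−(j−n)}))·α_{0,n}·ξ²(Lⁿξ)^{−2}` on `X ∩ (Ω_n ∖ Ω_{n+1})`.  So print needs `U_k ∈ U^c_j(X, α_{0,j}, α_{1,j})`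
ONLY FOR `X ⊂ Λ_j` (`⊂ Ω_j`); away from `Ω_j` the background is only `ε_n L^{−2n}`-regular ((2.7), `n < j`) and print never asks the scale-`j`
radius there.  11c's `∀ X` drops the range.

WHAT IS PROVED (the over-range bites, in kernel).
 §1 `one_sub_nReTr_le_norm_sub_one` (`1 − Re tr M∕N ≤ ‖M − 1‖_{op}`, via the tree's `norm_entry_le_l2_opNorm`), its similarity-invariant form.
 §2 ★ `one_sub_reTr_lt_of_mem_spaceI`: for ANY setting with `ι = ιSU N` and ANY residual recipe `Rz`, membership of `ofBackgroundC ι U` in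
    `spaceI S Rz M j Y α₀ α₁` forces `1 − Re tr U(∂p) < α₀·η_j²` at every plaquette INSIDE `Y` — the space is a union of `Gᶜ`-ORBITS of pairs
    satisfying (i)–(iv) (`B12RegularSpaces111.space`), (iii) (1.14) bounds `‖∂𝐔₀(p) − 1‖ < α₀ξ²` for the representative, `∂𝐔(p) = u(x)∂𝐔₀(p)u(x)⁻¹`
    (`plaq_gaugeU`), and the normalised trace is similarity-invariant (`nReTr_conj`) and `1`-Lipschitz (§1); (iv) and `Rz` only ADD constraints.
 §3 the ALL-EMPTY sequence `Ω_j = Λ_j = ∅` IS a `SeqOfRecord` of every length (`exists_seqOfRecord_forall_empty`; `Chain21` asks membership in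
    `𝐃_j` and two inclusions only); along it the determining set is all of scale `0` (`genSet_zero_of_forall_empty`, `genSet_eq_empty_of_forall_empty`),
    so `W₀` IS a minimiser of (2.12) for `𝐖` whenever `W₀` is `εreg`-small (`isMinimizer_W0_of_forall_empty` — a singleton constraint set, no [15]),
    the problem of record is SOLVABLE IN THE TREE there (`mem_solvableDom_of_forall_empty`), def-R's background IS `W₀`
    (`UbgMSOfRecord_eq_W0_of_forall_empty`, through def-R's own `eq_W0_of_isMinimizer_genSet`), and the support of record retains exactly the
    `cR·ε₀(g₀)`-small `W₀` (`mem_regSuppOfRecord_of_forall_empty`).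
 §4 ★ `bgProviso_forces_firstOrder_small`: `BgProviso` AS TYPED ⇒ EVERY scale-`0` configuration within `min(cR·ε₀(g₀), εreg)` of `1` obeys
    `1 − Re tr W₀(∂p) < α_{0,j}(g_j)·η_j²` at every plaquette inside every `X ∈ 𝐃_j`, every `1 ≤ j ≤ n` (general `N`).
 PART 2 (sibling `…K0BgProvisoOverRangeWitness`, imports this file) decides it at `N = 2`: an `SU(2)` one-bond witness inside a single-cube
    domain gives `¬ BgProviso` and `¬ Provisos₁₂ θ` for every `θ : Stage12Params F 2` with one windowed run of length `≥ 1` and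
    `α₀(g_n)·η_n²` small against `min(cR·ε₀(g₀), εreg)²` (print's regime: `α₀(g) = g·C₀(log g⁻²)^{q₀}`, `η_n² = L^{−2n}`).

THE REPAIR (for def-T's `Record13`, not typed here — a `def` is the definer's pen): restrict the `spaceI` conjunct of `BgProviso` to print's range,
`∀ X, Sect2.domSites (F.P K) M j X ⊆ s.Λ j → ofBackgroundC S.ι (U s W) ∈ spaceI …` (11b's `admE`∕`admR` ranges; the consumer
`norm_E_bg_le` is only ever summed there), keep the `spaceMS` conjunct (layered radii, layer `0` empty under `Seq.Ω_off`).  THEN the row is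
[15] = [Balaban1985Variational] Thm 1 (8) — the minimiser is `B₃ε₁`-regular for `ε₁`-regular data, scale by scale (NOT class membership
`εreg·η_j²`, which does not beat `α_{0,j}(g_j) → 0`) — plus (10)∕[13] for the (1.12)∕(2.38) gauges: N07's Theorem-1 slot read at def-R's
multi-scale objects (n11-e's located sentence, dag-lead OPS-NOTE-16).

DEPENDENCES (by name): `Node00.BgProviso`, `Sect2.spaceI ∕ frameI ∕ regionOfSet ∕ domSys ∕ domSites ∕ cubeDom ∕ liftIdx ∕ embedPair ∕
ofBackgroundC` (11b∕11c), `B12RegularSpaces111.space ∕ Satisfies ∕ CondIII ∕ act ∕ plaq`, `B12RegularSpaces111Gauge.plaq_gaugeU`,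
`Node00.UbgMSOfRecord ∕ regMSOfRecord ∕ omegaPlaqs ∕ eq_W0_of_isMinimizer_genSet ∕ isMinimizer_UbgMSOfRecord` (def-R FILE 16),
`Node00.regSuppOfRecord ∕ epsOfRecord ∕ solvableDom ∕ plaqInside ∕ cubeEnl` (def-R FILES 1, 13), `B15DeterminingSets.genSet ∕ gammaRegion_* ∕
IsMinimizer`, `B14.Eq218Concrete.Seq ∕ Chain21`, `Node00.empty_mem_unionsOfCubes`, `Node00.Stage12Params.Provisos₁₂ ∕ settingOfRecord₁₂ ∕
lfOfRecord₁₂ ∕ UbgOfRecord₁₂ ∕ suppOfRecord₁₂` (12b), `UnitaryModel.nReTr ∕ nReTr_conj ∕ nReTr_one`, `ιSU ∕ coe_ιSU ∕ MatA` (11d),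
`Literature.Barriers.QuantumFields.norm_entry_le_l2_opNorm`, Mathlib `Matrix.l2_opNorm_diagonal`, `Matrix.mem_specialUnitaryGroup_iff`.
-/

open scoped Matrix.Norms.L2Operator

namespace Summit.QuantumFields.YangMills.Theorems.K0BgProvisoOverRange

open Literature.MathematicalPhysics.QuantumFieldTheory.Balaban1983to89
open Literature.MathematicalPhysics.QuantumFieldTheory.Balaban1983to89.Node00
open Literature.MathematicalPhysics.QuantumFieldTheory.Balaban1983to89.T4Continuum

noncomputable section

/-! ## §1  Two matrix facts: the normalised real trace is `1`-Lipschitz against the operator norm and similarity-invariant -/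

/-- `1 − Re tr M ∕ N ≤ ‖M − 1‖_{op}` for every complex `N × N` matrix (`|A_ii| ≤ ‖A‖`, the tree's `norm_entry_le_l2_opNorm`). [folklore] -/
theorem one_sub_nReTr_le_norm_sub_one {N : ℕ} [NeZero N] (M : Matrix (Fin N) (Fin N) ℂ) :
    1 - UnitaryModel.nReTr M ≤ ‖M - 1‖ := by
  have hN : (0 : ℝ) < (Fintype.card (Fin N) : ℝ) := by
    rw [Fintype.card_fin]; exact_mod_cast Nat.pos_of_ne_zero (NeZero.ne N)
  have h1 : 1 - UnitaryModel.nReTr M = (Matrix.trace (1 - M)).re / Fintype.card (Fin N) := by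
    rw [← UnitaryModel.nReTr_one (n := Fin N)]
    simp only [UnitaryModel.nReTr, Matrix.trace_sub, Complex.sub_re, sub_div]
  rw [h1, div_le_iff₀ hN]
  calc (Matrix.trace (1 - M)).re ≤ ‖Matrix.trace (1 - M)‖ := Complex.re_le_norm _
    _ = ‖∑ i, (1 - M) i i‖ := by simp [Matrix.trace]
    _ ≤ ∑ i, ‖(1 - M) i i‖ := norm_sum_le _ _
    _ ≤ ∑ _i : Fin N, ‖1 - M‖ :=
        Finset.sum_le_sum fun i _ => Literature.Barriers.QuantumFields.norm_entry_le_l2_opNorm (1 - M) i i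
    _ = ‖M - 1‖ * Fintype.card (Fin N) := by
        rw [Finset.sum_const, Finset.card_univ, nsmul_eq_mul, norm_sub_rev, mul_comm]

/-- The same after a similarity `M ↦ V·M·W`, `W·V = 1` (the trace is similarity-invariant, `UnitaryModel.nReTr_conj`). [folklore] -/
theorem one_sub_nReTr_le_norm_conj_sub_one {N : ℕ} [NeZero N] {M V W : Matrix (Fin N) (Fin N) ℂ} (hWV : W * V = 1) :
    1 - UnitaryModel.nReTr M ≤ ‖V * M * W - 1‖ := by
  rw [← UnitaryModel.nReTr_conj (U := M) hWV]
  exact one_sub_nReTr_le_norm_sub_one _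

/-- For `g ∈ SU(N)`, `Setup`'s `reTr g` IS `Re tr g ∕ N` of the matrix (`rfl` through `GaugeGroup.ofUnitaryRep`). [folklore] -/
theorem reTr_eq_nReTr {N : ℕ} [NeZero N] (g : SU N) : reTr g = UnitaryModel.nReTr (g : MatA N) := rfl

/-- The plaquette variable of an embedded configuration is the embedded plaquette variable (`ι` is a monoid hom). [folklore] -/
theorem plaq_comp_hom {P : Params} {i : ℕ} {G H : Type*} [Group G] [Group H] (f : G →* H) (U : PBond P i → G) (p : Plaq P i) :
    B12RegularSpaces111.plaq (fun b => f (U b)) p = f (B12RegularSpaces111.plaq U p) := by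
  simp only [B12RegularSpaces111.plaq_eq, map_mul, map_inv]

/-! ## §2  What membership in `U^c_j(X, α₀, α₁)` of record FORCES on a real background: the gauge-invariant first-order bound -/

/-- **MEMBERSHIP IN `U^c_j(X, α₀, α₁)` OF RECORD FORCES `1 − Re tr U(∂p) < α₀·η_j²` ON EVERY PLAQUETTE INSIDE `X`** — for ANY setting whose
embedding is `ιSU N` and ANY residual recipe `Rz`: the space is a union of `Gᶜ`-orbits of pairs satisfying (i)–(iv), (iii) (1.14) bounds
`‖∂𝐔₀(p) − 1‖_{op} < α₀ξ²` for the orbit representative `𝐔₀`, `∂𝐔(p) = u(x)·∂𝐔₀(p)·u(x)⁻¹` (`plaq_gaugeU`), and the normalised real trace is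
similarity-invariant and `1`-Lipschitz (§1).  (Condition (iv) and the recipe `Rz` only ADD constraints.) [cite: Balaban1987RG1, (1.10)–(1.14) p.262] -/
theorem one_sub_reTr_lt_of_mem_spaceI {N : ℕ} [NeZero N] {P : Params} (S : Sect2.Setting (MatA N) (SU N)) (hι : S.ι = ιSU N)
    (Rz : Sect2.Residual P (MatA N)) (M j : ℕ) (Y : Set (Site P 0)) (α₀ α₁ : ℝ) (U : GaugeField P 0 (SU N))
    (hU : Sect2.ofBackgroundC S.ι U ∈ Sect2.spaceI S Rz M j Y α₀ α₁) :
    ∀ p ∈ plaqInside Y, 1 - reTr (GaugeField.plaqHol U p) < α₀ * P.eta j ^ 2 := by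
  intro p hp
  obtain ⟨Ψ, hΨ, hΨU⟩ := hU
  obtain ⟨u, Φ₀, -, hSat, hact⟩ := hΨ
  obtain ⟨-, -, -, -, -, -, -, h3, -, -⟩ := hSat
  -- (iii) for the representative, at the plaquette `p ⊂ X`
  have hp' : p ∈ (B12RegularSpaces111.Frame.X (Sect2.frameI Rz M j Y)).plaqs := hp
  have hlt := h3.plaq_lt p hp'
  -- the units-valued first component of `Ψ` is `ι ∘ U`
  have hΨ1 : Ψ.U = fun b => ιSU N (U b) := by
    funext b
    have hb := congrArg (fun φ : Sect2.CPair P (MatA N) => φ.1 b) hΨU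
    simp only [Sect2.embedPair, Sect2.ofBackgroundC, hι] at hb
    exact Units.ext hb
  -- `∂Ψ(p) = u(x) ∂Φ₀(p) u(x)⁻¹`
  have hconj : B12RegularSpaces111.plaq Ψ.U p = u p.src * B12RegularSpaces111.plaq Φ₀.U p * (u p.src)⁻¹ := by
    rw [hact]
    exact B12RegularSpaces111Gauge.plaq_gaugeU u Φ₀.U p
  -- `∂Ψ(p)` is the matrix `U(∂p)`
  have hmat : ((B12RegularSpaces111.plaq Ψ.U p : (MatA N)ˣ) : MatA N) = ((GaugeField.plaqHol U p : SU N) : MatA N) := by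
    rw [hΨ1, plaq_comp_hom, B12RegularSpaces111.plaq_eq_plaqHol, coe_ιSU]
  have hWV : ((u p.src : (MatA N)ˣ) : MatA N) * (((u p.src)⁻¹ : (MatA N)ˣ) : MatA N) = 1 := by
    rw [← Units.val_mul, mul_inv_cancel, Units.val_one]
  have key : 1 - UnitaryModel.nReTr ((GaugeField.plaqHol U p : SU N) : MatA N) ≤
      ‖((B12RegularSpaces111.plaq Φ₀.U p : (MatA N)ˣ) : MatA N) - 1‖ := by
    have h := one_sub_nReTr_le_norm_conj_sub_one
      (M := ((B12RegularSpaces111.plaq Ψ.U p : (MatA N)ˣ) : MatA N))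
      (V := (((u p.src)⁻¹ : (MatA N)ˣ) : MatA N)) (W := ((u p.src : (MatA N)ˣ) : MatA N)) hWV
    have hΦ₀ : (((u p.src)⁻¹ : (MatA N)ˣ) : MatA N) * ((B12RegularSpaces111.plaq Ψ.U p : (MatA N)ˣ) : MatA N) *
        ((u p.src : (MatA N)ˣ) : MatA N) = ((B12RegularSpaces111.plaq Φ₀.U p : (MatA N)ˣ) : MatA N) := by
      rw [hconj, ← Units.val_mul, ← Units.val_mul]
      congr 1
      group
    rwa [hΦ₀, hmat] at h
  rw [reTr_eq_nReTr]
  exact lt_of_le_of_lt key hlt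

/-! ## §3  The all-empty sequence of record: its (2.12) problem is solvable IN THE TREE, with minimiser `W₀` -/

section EmptySeq

open B15DeterminingSets

variable {F : T4Family} {N : ℕ} [NeZero N]

/-- **The all-empty sequence `Ω_j = Λ_j = ∅` is a (2.18) index of record of every length** (the term «the whole lattice is large field from
step 1 on»; `Chain21` asks only membership in `𝐃_j` — `∅` is a union of no cubes — and the two inclusions). [cite: Balaban1988Convergent, (2.1) p.254, (2.18) p.257] -/
theorem exists_seqOfRecord_forall_empty (ν : Stage7Numerics) (M : ℕ) (g : ℕ → ℝ) (K n : ℕ) :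
    ∃ s : SeqOfRecord F ν M g K n, ∀ j, s.Ω j = ∅ := by
  refine ⟨⟨fun _ => ∅, fun _ => ∅, ⟨fun j _ _ => ?_, fun j _ _ => ?_, fun _ _ _ => le_rfl, fun _ _ _ => le_rfl⟩,
    fun _ _ => rfl, fun _ _ => rfl⟩, fun _ => rfl⟩
  · exact empty_mem_unionsOfCubes _ _
  · exact empty_mem_unionsOfCubes _ _

variable {P : Params}

/-- Along an all-empty sequence of positive length the scale-`0` member of the determining set is EVERYTHING (`Γ₀ = Ω₁ᶜ = T`).
[cite: Balaban1988Convergent, (2.2) p.255, (2.10)–(2.11) p.256] -/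
theorem genSet_zero_of_forall_empty {Ω : ℕ → Set (Site P 0)} (hΩ : ∀ j, Ω j = ∅) {n : ℕ} (hn : 0 < n) :
    genSet Ω n 0 = Set.univ := by
  show pts 0 (gammaRegion Ω n 0) = Set.univ
  rw [gammaRegion_zero Ω hn, hΩ 1, Set.compl_empty]
  rfl

/-- … and every positive-scale member is EMPTY. [cite: Balaban1988Convergent, (2.2) p.255, (2.10)–(2.11) p.256] -/
theorem genSet_eq_empty_of_forall_empty {Ω : ℕ → Set (Site P 0)} (hΩ : ∀ j, Ω j = ∅) (n : ℕ) {j : ℕ} (hj : 1 ≤ j) :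
    genSet Ω n j = ∅ := by
  show pts j (gammaRegion Ω n j) = ∅
  have hγ : gammaRegion Ω n j = ∅ := by
    rcases lt_trichotomy j n with hlt | rfl | hgt
    · rw [gammaRegion_mid Ω (by omega) hlt, hΩ j, Set.empty_sdiff]
    · rw [gammaRegion_self, hΩ j]
    · rw [gammaRegion_of_gt Ω hgt]
  rw [hγ]
  rfl

/-- The bonds «touching» the empty site set: none. [cite: Balaban1988Convergent, (2.11) p.256 (bookkeeping)] -/
theorem not_mem_bondsOf_empty {j : ℕ} (b : PBond P j) : b ∉ bondsOf (∅ : Set (Site P j)) := by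
  simp [bondsOf]

/-- The plaquettes «touching» the empty site set: none. [cite: Balaban1985RegularSpaces, p.77 (bookkeeping)] -/
theorem not_mem_plaqsOf_empty {j : ℕ} (p : Plaq P j) : p ∉ B8Eq17ClassAkV1.plaqsOf (∅ : Set (Site P j)) := by
  simp [B8Eq17ClassAkV1.plaqsOf]

/-- **Along an all-empty sequence of positive length, `W₀` IS a minimiser of (2.12)** for the data `𝐖` as soon as `W₀` lies in the class: the
determining set pins every scale-`0` bond (`M⁰ = id`), so the constraint set is `{W₀}`.  (No [15] needed: a singleton problem.) [cite: Balaban1988Convergent, (2.12) p.256] -/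
theorem isMinimizer_W0_of_forall_empty {G : Type*} [GaugeGroup G] (av : ∀ j, Averaging P j G) (reg : Set (GaugeField P 0 G))
    {Ω : ℕ → Set (Site P 0)} (hΩ : ∀ j, Ω j = ∅) {n : ℕ} (hn : 0 < n) (W : MSField P G) (hW : W 0 ∈ reg) :
    IsMinimizer av reg (genSet Ω n) W (W 0) := by
  refine ⟨hW, fun j b hb => ?_, fun U _ hagree => ?_⟩
  · by_cases hj : j = 0
    · subst hj; rfl
    · exfalso
      rw [genSet_eq_empty_of_forall_empty hΩ n (Nat.one_le_iff_ne_zero.mpr hj)] at hb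
      exact not_mem_bondsOf_empty b hb
  · have hU : U = W 0 := by
      funext b
      have hb : b ∈ bondsOf (genSet Ω n 0) := by
        rw [genSet_zero_of_forall_empty hΩ hn]
        exact Or.inl (Set.mem_univ _)
      exact hagree 0 b hb
    rw [hU]

/-- The scale-`0` field of an all-empty-sequence datum lies in print's class `U_n({Ω_j}, εreg)` iff it is GLOBALLY `εreg`-small (the positive-scale
clauses quantify over no plaquette). [cite: Balaban1985RegularSpaces, (1.7) p.77] -/
theorem mem_regMSOfRecord_of_forall_empty (ν : Stage7Numerics) (K n : ℕ) {Ω : ℕ → Set (Site (F.P K) 0)} (hΩ : ∀ j, Ω j = ∅)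
    {U : GaugeField (F.P K) 0 (SU N)} (hU : PlaqSmall ν.εreg U) : U ∈ regMSOfRecord F N ν K n Ω := by
  intro j _ p hp
  by_cases hj : j = 0
  · subst hj
    have h1 : (F.P K).eta 0 = 1 := by simp [Params.eta]
    rw [h1, one_pow, mul_one]
    exact hU p
  · rw [omegaPlaqs_of_ne_zero Ω hj, hΩ j] at hp
    exact (not_mem_plaqsOf_empty p hp).elim

/-- **SOLVABILITY IN THE TREE along an all-empty sequence**: every datum whose scale-`0` field is `εreg`-small is in the solvable set of the
(2.12) problem of record. [cite: Balaban1988Convergent, (2.12) p.256] -/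
theorem mem_solvableDom_of_forall_empty (ν : Stage7Numerics) (K : ℕ) {n : ℕ} (hn : 0 < n) {Ω : ℕ → Set (Site (F.P K) 0)}
    (hΩ : ∀ j, Ω j = ∅) (W : MSField (F.P K) (SU N)) (hW : PlaqSmall ν.εreg (W 0)) :
    W ∈ solvableDom (avOfRecord F N K) (regMSOfRecord F N ν K n Ω) (genSet Ω n) :=
  ⟨W 0, isMinimizer_W0_of_forall_empty _ _ hΩ hn W (mem_regMSOfRecord_of_forall_empty ν K n hΩ hW)⟩

/-- **def-R's BACKGROUND OF RECORD along an all-empty sequence IS `W₀`** (any minimiser equals `W₀` on the bonds sourced in `Ω₁ᶜ = T`,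
`eq_W0_of_isMinimizer_genSet`). [cite: Balaban1988Convergent, (2.12)–(2.13) pp.256–257] -/
theorem UbgMSOfRecord_eq_W0_of_forall_empty (ν : Stage7Numerics) (M : ℕ) (g : ℕ → ℝ) (K : ℕ) {n : ℕ} (hn : 0 < n)
    (s : SeqOfRecord F ν M g K n) (hs : ∀ j, s.Ω j = ∅) (W : MSField (F.P K) (SU N)) (hW : PlaqSmall ν.εreg (W 0)) :
    UbgMSOfRecord F N ν M g K n s W = W 0 := by
  funext b
  exact eq_W0_of_isMinimizer_genSet (avOfRecord F N K) _ hn s.Ω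
    (isMinimizer_UbgMSOfRecord ν M g K n s (mem_solvableDom_of_forall_empty ν K hn hs W hW)) b (by simp [hs 1])

/-- **The support of record along an all-empty sequence** retains exactly the data whose scale-`0` field is `cR·ε₀`-small: globally small
`W₀` are retained. [cite: Balaban1988Convergent, (2.10) p.256] -/
theorem mem_regSuppOfRecord_of_forall_empty (ν : Stage7Numerics) (M : ℕ) (g : ℕ → ℝ) (K n : ℕ) (cR : ℝ) (s : SeqOfRecord F ν M g K n)
    (hs : ∀ j, s.Ω j = ∅) (W : MSField (F.P K) (SU N)) (hW : PlaqSmall (cR * epsOfRecord ν g 0) (W 0)) :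
    W ∈ regSuppOfRecord F N ν M g K n cR s := by
  intro j _ p hp
  by_cases hj : j = 0
  · subst hj
    exact hW p
  · rw [genSet_eq_empty_of_forall_empty hs n (Nat.one_le_iff_ne_zero.mpr hj)] at hp
    exact (not_mem_plaqsOf_empty p hp).elim

end EmptySeq

/-! ## §4  THE LOCATED OVER-RANGE: `BgProviso` forces global first-order `α_{0,j}η_j²`-smallness of every retained small field -/

section Forces

variable {F : T4Family} {N : ℕ} [NeZero N]

/-- A multi-scale datum with prescribed scale-`0` field and unit fields above (bookkeeping). [cite: Balaban1988Convergent, (2.11) p.256 (bookkeeping)] -/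
theorem exists_msField_zero {P : Params} {G : Type*} [GaugeGroup G] (W₀ : GaugeField P 0 G) :
    ∃ W : B15DeterminingSets.MSField P G, W 0 = W₀ :=
  ⟨fun i => Nat.rec (motive := fun i => GaugeField P i G) W₀ (fun _ _ => fun _ => 1) i, rfl⟩

/-- **THE OVER-RANGE, IN KERNEL.**  If 11c's background proviso holds AS TYPED — `U^c_j(X, α_{0,j}, α_{1,j})`-membership of def-R's background
`U_n(s)(𝐖)` for EVERY `X ∈ 𝐃_j`, every `1 ≤ j ≤ n`, every sequence and every retained `𝐖` — then EVERY scale-`0` configuration within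
`min(cR·ε₀(g₀), εreg)` of `1` obeys the first-order bound `1 − Re tr W₀(∂p) < α_{0,j}(g_j)·η_j²` at EVERY plaquette inside EVERY localization domain,
at EVERY scale `j ≤ n` (read at the all-empty sequence, where `U_n(s)(𝐖) = W₀`, §3).  Print asserts the membership only for `X ⊂ Λ_j` ((2.27):
«Σ_{X ∈ 𝐃_j, z ∈ X ⊂ Λ_j}», p.259 «(2.7) imply U_k ∈ U^c_j(X, α_{0,j}, α_{1,j})»). [cite: Balaban1988Convergent, (2.27)–(2.28) p.259] -/
theorem bgProviso_forces_firstOrder_small {K : ℕ} (S : Sect2.Setting (MatA N) (SU N)) (hι : S.ι = ιSU N) (Rz : Sect2.Residual (F.P K) (MatA N))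
    {ν : Stage7Numerics} {M : ℕ} {g : ℕ → ℝ} {n : ℕ} {cR : ℝ} (hn : 1 ≤ n)
    (h : BgProviso F N K S Rz M n (regSuppOfRecord F N ν M g K n cR) (UbgMSOfRecord F N ν M g K n))
    (W₀ : GaugeField (F.P K) 0 (SU N)) (hreg : PlaqSmall ν.εreg W₀) (hsupp : PlaqSmall (cR * epsOfRecord ν g 0) W₀)
    {j : ℕ} (h1 : 1 ≤ j) (hj : j ≤ n) (X : (Sect2.domSys (F.P K) M j).Dom) :
    ∀ p ∈ plaqInside (Sect2.domSites (F.P K) M j X),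
      1 - reTr (GaugeField.plaqHol W₀ p) < S.lf.alpha0 (S.flow.g j) * (F.P K).eta j ^ 2 := by
  obtain ⟨s, hs⟩ := exists_seqOfRecord_forall_empty (F := F) ν M g K n
  obtain ⟨W, hW⟩ := exists_msField_zero W₀
  have hmem := (h s W (mem_regSuppOfRecord_of_forall_empty ν M g K n cR s hs W (hW ▸ hsupp)) j h1 hj X).1
  rw [UbgMSOfRecord_eq_W0_of_forall_empty ν M g K hn s hs W (hW ▸ hreg), hW] at hmem
  exact one_sub_reTr_lt_of_mem_spaceI S hι Rz M j _ _ _ W₀ hmem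

end Forces

end

end Summit.QuantumFields.YangMills.Theorems.K0BgProvisoOverRange
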